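import Summits.ValiantsHypothesis.ValiantsHypothesis.Theorems.KPlusLogSqLawStaticPathCertSixteenPart5
import Summits.ValiantsHypothesis.ValiantsHypothesis.Theorems.KPlusLogSqLawStaticPathChainFloorAdjacent

/-!
# Route «KPlusLogSqLaw» — KERNEL FLOOR `28·⌊m/16⌋` (rate `7/4`) for the static path sector's tropical count

HONEST FRAMING.  Helper toward the crux `WeakLifting` (item `stmt-ValiantsHypothesis-19561`, route `KPlusLogSqLaw`, cell `pub-symmetroid`,
seat val-sym-lift-p4 g10, 2026-08-27): tropical twin of the STATIC tridiagonal sector = parametric max-weight independent set on a path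
(a block of `m` items with item lines `W t θ = w₁ t θ + w₀ t`; a «chain of N changes» = `N + 1` parameters with pairwise distinct UNIQUE optima
at consecutive parameters, the kernel currency of `…StaticPathChain*`).  The located `n = 16` instance with `28 = 2·16 − 4` changes
(val-sym-lift-p4 g10, `HOME/val-sym-lift-p4/g10/data/located_g10.txt`; kernel certificate `exists_chain_twentyeight_on_sixteen_rev_ends`,
parts `…CertSixteenPart1..5`) has the END FACTS needed by the separator-free gluing of g9 (`chain_glue_adj` via
`exists_chain_ends_of_rev_ends` / `exists_chain_floor_adj` of `…ChainFloorAdjacent`): after time reversal its first optimum avoids item `1`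
and its last optimum avoids item `16`, so copies glue WITHOUT a separator item.  Consequences typed here: a free-ends chain of `28` changes on
`16` items (`exists_chain_ends_sixteen`), hence `28·⌊m/16⌋` changes on EVERY `m`-block (`exists_chain_floor_sixteen_adj`) — asymptotic rate
`28/16 = 7/4 = 1.75` changes per item, above the previous kernel floor `26/15 ≈ 1.733` (`exists_chain_floor_fifteen_adj`, g9); the located
all-`n` family F6 (rate `11/6`, LINEAR-LAW §4.5) is still not in the kernel, and the kernel CEILING is `O(n log n)` (`exists_cert_opt`, lift-p3 g6).
Nothing here asserts anything about `WeakLifting`, `TropicalB`, `KPlusLogSqLaw`, the stub `stub_tridiagonalSectorB` in its window,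
`MatrixDescartes` (stmt-ValiantsHypothesis-18050) or `VP ≠ VNP`.
-/

set_option linter.dupNamespace false
set_option autoImplicit false

namespace Summit.ValiantsHypothesis.ValiantsHypothesis.Theorems.KPlusLogSqLaw

open Finset Classical

namespace StaticPathFold

noncomputable section

/-- **the `n = 16` certificate with free ends** (time-reversed located instance): 28 changes on 16 items, first optimum avoiding item `1`,
last optimum avoiding item `16`. [folklore] -/
theorem exists_chain_ends_sixteen :
    ∃ (w₁ w₀ : ℕ → ℝ) (θs : Fin (28 + 1) → ℝ) (Ms : Fin (28 + 1) → Finset ℕ),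
      StrictMono θs ∧ (∀ k, Ms k ∈ indepSets 0 16) ∧
      (∀ k, ∀ S ∈ indepSets 0 16, S ≠ Ms k → ∑ t ∈ S, W w₁ w₀ t (θs k) < ∑ t ∈ Ms k, W w₁ w₀ t (θs k)) ∧
      (∀ e : Fin 28, Ms e.castSucc ≠ Ms e.succ) ∧ 1 ∉ Ms 0 ∧ 16 ∉ Ms (Fin.last 28) :=
  exists_chain_ends_of_rev_ends exists_chain_twentyeight_on_sixteen_rev_ends

/-- **KERNEL FLOOR `28·⌊m/16⌋` ON EVERY `m`-BLOCK** (the located `n = 16` instance glued to itself without separators; rate `7/4`,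
the sector's best kernel floor as of this file; located truth `2n − 4` for `5 ≤ n ≤ 16`). [folklore] -/
theorem exists_chain_floor_sixteen_adj (m : ℕ) :
    ∃ (w₁ w₀ : ℕ → ℝ) (θs : Fin (28 * (m / 16) + 1) → ℝ) (Ms : Fin (28 * (m / 16) + 1) → Finset ℕ),
      StrictMono θs ∧ (∀ j, Ms j ∈ indepSets 0 m) ∧
      (∀ j, ∀ S ∈ indepSets 0 m, S ≠ Ms j → ∑ t ∈ S, W w₁ w₀ t (θs j) < ∑ t ∈ Ms j, W w₁ w₀ t (θs j)) ∧
      (∀ e : Fin (28 * (m / 16)), Ms e.castSucc ≠ Ms e.succ) :=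
  exists_chain_floor_adj exists_chain_ends_sixteen m

/-- the rate of the floor: `28·⌊m/16⌋ ≥ (28 m − 420)/16`, i.e. asymptotic rate `28/16 = 7/4` changes per item. [folklore] -/
theorem floor_sixteen_adj_rate (m : ℕ) : 28 * m ≤ 16 * (28 * (m / 16)) + 420 := by
  have := Nat.div_add_mod m 16
  have := Nat.mod_lt m (show 0 < 16 by norm_num)
  omega

/-- the new floor constant beats the previous one: `7/4 > 26/15` (as `28·15 > 26·16`). [folklore] -/
theorem floor_sixteen_rate_gt_fifteen_rate : 26 * 16 < 28 * 15 := by norm_num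

end

end StaticPathFold

end Summit.ValiantsHypothesis.ValiantsHypothesis.Theorems.KPlusLogSqLaw
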